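import Summits.HodgeConjecture.HodgeConjecture.Theses.AmpleAdicLefschetz
import Literature.AlgebraicGeometry.HodgeTheory.LefschetzPencilHyperplaneSectionsProofs
import Literature.AlgebraicGeometry.HodgeTheory.VanishingCohomologyNontrivialProofs
import Literature.AlgebraicGeometry.HodgeTheory.AlgebraicityLocusWitnesses
import Literature.AlgebraicGeometry.HodgeTheory.CurvePoleSpaces
import Literature.AlgebraicGeometry.Resolution.RationalFunctionsToProjectiveSpace
import Literature.AlgebraicGeometry.Morphisms.FiniteOfClosedFibres
import Literature.AlgebraicGeometry.Motives.VarietiesUnitProofs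
import Literature.AlgebraicGeometry.Motives.AbelianVarietyTorsionFiniteProofs
import Literature.AlgebraicGeometry.Motives.CurveNet
import HarnessLib

/-!
# Crux `SectionalSource` (stmt-HodgeConjecture-10725), line `birth` — stub `stub_supply`

BERTINI SUPPLY OF AFFINE-COMPLEMENT HYPERPLANE SECTIONS: every smooth projective complex variety `X`
of dimension `n ≥ 1` contains a smooth projective closed subscheme `Y` of dimension `n − 1` whose
complement is ONE non-empty AFFINE open.

* `n ≥ 2` (`stub_supply_of_two_le`): embed `ι : X ↪ ℙᴺ` (`IsSmoothProjective.isProjectiveOver`),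
  take a good pencil of hyperplane sections `a = (a₀, a₁)` (`exists_goodPencil`: the members
  `π⁻¹(s)` of the net of linear sections `X ← X̃ → ℙ¹` over the complex points `s` off a proper
  closed `T ⊊ ℙ¹` are smooth projective of dimension `n − 1`), pick a complex point `s = [w]` of
  `ℙ¹` off `T` (`ComplexPoints.exists_pt_mem`), and set `Y = π⁻¹(s)`,
  `f = u_s : π⁻¹(s) ⟶ X̃ ⟶ X` (a closed immersion, `isClosedImmersion_fiberι_blowDown_left`). On
  complex points the image of `u_s` is the hyperplane section `X ∩ V₊(w₁ a₀ − w₀ a₁)`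
  (`range_map_fiberι_blowDown`), hence also on scheme points (two closed subsets of a `ℂ`-scheme
  locally of finite type with the same complex points agree, `eq_of_isClosed_of_forall_pt_mem_iff`);
  so `X ∖ f(Y) = X ∩ D₊(ℓ) = ι⁻¹ D₊(ℓ)` is affine (Mathlib `Proj.isAffineOpen_basicOpen` and
  `IsAffineOpen.preimage` along the closed immersion `ι`, packaged as
  `Resolution.LinSec.isAffineOpen_XL`), and non-empty because a surjective closed immersion from
  the `(n − 1)`-fold `Y` onto the `n`-fold `X` would be a homeomorphism
  (`eq_of_isSmoothProjective_of_isHomeomorph`).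
* `n = 1` (`stub_supply_one`): for a complex point `P` of the curve `X`, Riemann's inequality
  (`le_finrank_sections_smul_pointDivisor`: `dim Γ(X, 𝒪((g+1)·[P])) ≥ 2`) and `Γ(X, 𝒪_X) = ℂ`
  (`CurvePlaces.h0_zero`) give a rational function `f` regular exactly off `P`
  (`exists_isRegularAt_iff_ne_pt`); the rational map `(1 : f) : X → ℙ¹` is everywhere defined
  (the local rings are valuation rings; `Resolution.toProjOfVec`), proper, with finite fibres over
  closed points, hence FINITE (Zariski's Main Theorem,
  `Morphisms.isFinite_of_isProper_of_finite_preimage_closedPoint`), so that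
  `X ∖ P = {f regular} = φ⁻¹ D₊(x₀)` is affine; `Y = Spec ℂ ⟶ X` is the closed point `P`.

## References

* [Hartshorne1977] R. Hartshorne, Algebraic Geometry (1977), II Prop. 2.5, II Thm. 7.1, II Thm. 8.18,
  III Cor. 7.9, IV.1 Thm. 1.3.
* [VoisinHodgeII2003] C. Voisin, Hodge Theory and Complex Algebraic Geometry II (2003), §2.1.1.
-/

noncomputable section

-- mandated namespace `Summit.HodgeConjecture.HodgeConjecture.Theorems` (single-problem summit: Problem =
-- Summit) trips `linter.dupNamespace`; off tree-wide in the lakefile, restated for stand-alone elaboration.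
set_option linter.dupNamespace false

namespace Summit.HodgeConjecture.HodgeConjecture.Theorems

open CategoryTheory AlgebraicGeometry MonoidalCategory
open Literature.AlgebraicGeometry Literature.AlgebraicGeometry.Motives
open Literature.AlgebraicGeometry.Motives.LinearSectionNet Literature.AlgebraicGeometry.Motives.RatFn
open Literature.AlgebraicGeometry.HodgeTheory

attribute [local instance] MvPolynomial.gradedAlgebra

section Pencil

variable {N : ℕ} {X : SchemeOver ℂ} (ι : X ⟶ projectiveSpace N ℂ) [IsClosedImmersion ι.left]
  (a : Fin (1 + 1) → Fin (N + 1) → ℂ)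

/-- A complex point `P` of `X ⊆ ℙᴺ` lies on the hyperplane-section subset
`hyp ι (w₁ a₀ − w₀ a₁) = X ∖ ι⁻¹ D₊(ℓ)` iff it lies in the image of the closed immersion
`X ∩ V₊(ℓ) ↪ X` (`range_hypersurfaceSectionι`: that image is `ι⁻¹ V₊(ℓ)`). -/
theorem pt_mem_hyp_iff_mem_range_hypersurfaceSectionι (w : Fin (1 + 1) → ℂ) (P : ComplexPoints X) :
    P.pt ∈ Resolution.LinSec.hyp (ιPP ι) (fun c ↦ w 1 * a 0 c - w 0 * a 1 c) ↔
      P.pt ∈ Set.range ((⟨N, ι, inferInstance⟩ : ProjectiveEmbedding X).hypersurfaceSectionι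
          (Resolution.LinSec.linForm (fun c ↦ w 1 * a 0 c - w 0 * a 1 c))
          (isHomogeneous_linForm_member a w)).left := by
  set e : ProjectiveEmbedding X := ⟨N, ι, inferInstance⟩ with he
  rw [range_hypersurfaceSectionι _ _ _ one_pos, Set.mem_preimage, Resolution.LinSec.mem_hyp_iff]
  change ¬ (e.toProj P.pt ∈
      Proj.basicOpen _ (Resolution.LinSec.linForm (fun c ↦ w 1 * a 0 c - w 0 * a 1 c))) ↔ _
  rw [Proj.mem_basicOpen, not_not]
  exact ((ProjectiveSpectrum.mem_zeroLocus _ _ _).trans Set.singleton_subset_iff).symm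

/-- **The image of `u_s : π⁻¹(s) ⟶ X̃ ⟶ X` on scheme points is the hyperplane section
`X ∩ V₊(w₁ a₀ − w₀ a₁)`** (`s = [w]`): both are closed subsets of the `ℂ`-scheme `X` locally of
finite type, and they have the same complex points (`range_map_fiberι_blowDown`). -/
theorem range_fiberι_blowDown_base_eq_hyp [LocallyOfFiniteType X.hom] (w : Fin (1 + 1) → ℂ)
    (hw : w ≠ 0) :
    Set.range (fiberι (proj ι a) (ProjectiveSpace.pointOfVec ℂ w hw) ≫ blowDown ι a).left.base =
      Resolution.LinSec.hyp (ιPP ι) (fun c ↦ w 1 * a 0 c - w 0 * a 1 c) := by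
  haveI := isClosedImmersion_fiberι_blowDown_left ι a (ProjectiveSpace.pointOfVec ℂ w hw)
  refine eq_of_isClosed_of_forall_pt_mem_iff
    (fiberι (proj ι a) (ProjectiveSpace.pointOfVec ℂ w hw) ≫
      blowDown ι a).left.isClosedEmbedding.isClosed_range
    (Resolution.LinSec.isClosed_hyp _ _) fun P ↦ ?_
  rw [pt_mem_hyp_iff_mem_range_hypersurfaceSectionι ι a w P,
    ← AlgPoints.mem_range_map_iff_pt_mem, ← AlgPoints.mem_range_map_iff_pt_mem,
    range_map_fiberι_blowDown ι a w hw]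

end Pencil

section Curve

variable (X : SchemeOver ℂ) [IsIntegral X.left] [SmoothOfRelativeDimension 1 X.hom] [IsProper X.hom]

/-- **A rational function with a pole at exactly one prescribed complex point.** On a smooth
complete geometrically integral complex curve `X` and for a complex point `P`, there is
`f ∈ K(X)` regular at every point other than `P` and NOT regular at `P`: by Riemann's inequality
`dim Γ(X, 𝒪((g+1)·[P])) ≥ 2` (`le_finrank_sections_smul_pointDivisor`), while the everywhere
regular rational functions form the `1`-dimensional space `Γ(X, 𝒪_X) = ℂ` (`CurvePlaces.h0_zero`),
and sections of `𝒪(N·[P])` are regular off `P` (`isRegularAt_of_mem_sections_smul_pointDivisor`). -/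
theorem exists_isRegularAt_iff_ne_pt [GeometricallyIntegral X.hom] (P : ComplexPoints X) :
    ∃ f : X.left.functionField, ∀ y : X.left, IsRegularAt y f ↔ y ≠ P.pt := by
  have hP := pt_ne_genericPoint X P
  set N := CurvePlaces.curveGenus X + 1 with hN
  haveI := finiteDimensional_sections_smul_pointDivisor X hP N
  have hrank := le_finrank_sections_smul_pointDivisor X P N
  -- some section of `(g+1)·[P]` is not regular at `P`
  have key : ∃ f ∈ (N • CurvePlaces.pointDivisor X hP).sections ℂ, ¬ IsRegularAt P.pt f := by
    by_contra hcon
    push Not at hcon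
    -- otherwise every section of `(g+1)·[P]` is regular everywhere, i.e. a section of the zero divisor
    have hle : (N • CurvePlaces.pointDivisor X hP).sections ℂ ≤
        (0 : CartierDivisor X.left).sections ℂ := by
      intro f hf
      rw [CartierDivisor.mem_sections_iff]
      intro i x _
      rw [CartierDivisor.zero_f, one_mul]
      by_cases hx : x = P.pt
      · rw [hx]; exact hcon f hf
      · exact isRegularAt_of_mem_sections_smul_pointDivisor X hP hf hx
    have h0 := CurvePlaces.h0_zero X
    unfold CartierDivisor.h0 at h0
    haveI : Module.Finite ℂ ((0 : CartierDivisor X.left).sections ℂ) :=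
      Module.finite_of_finrank_eq_succ h0
    have hmono := Submodule.finrank_mono hle
    omega
  obtain ⟨f, hf, hfP⟩ := key
  exact ⟨f, fun y ↦ ⟨fun h hy ↦ hfP (hy ▸ h),
    fun hy ↦ isRegularAt_of_mem_sections_smul_pointDivisor X hP hf hy⟩⟩

variable {X}

omit [SmoothOfRelativeDimension 1 X.hom] [IsProper X.hom] in
/-- The `0`-th chart of the linear system `(1 : f)` — where the rational map `x ↦ (1 : f(x))` is
defined through `D₊(x₀)` — is the locus where `f` is regular. -/
theorem mem_lsChart_pair_zero_iff (f : X.left.functionField) (x : X.left) :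
    x ∈ Resolution.lsChart (![1, f] : Fin (1 + 1) → X.left.functionField) 0 ↔ IsRegularAt x f := by
  rw [Resolution.mem_lsChart_iff, Fin.forall_fin_two]
  simp only [Fin.isValue, Matrix.cons_val_zero, Matrix.cons_val_one, ne_eq, one_ne_zero,
    not_false_eq_true, true_and, div_one]
  exact ⟨fun h ↦ h.2, fun h ↦ ⟨isRegularAt_one, h⟩⟩

omit [IsProper X.hom] in
/-- **On a smooth curve the rational map `(1 : f)` to `ℙ¹` is everywhere defined** (`f ≠ 0`): at a
point where `f` is not regular, `f⁻¹` is (the local ring is a valuation ring of `K(X)`,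
`CurvePlaces.place`), so the point lies in the chart `D₊(x₁)`. -/
theorem isDefinedAt_pair {f : X.left.functionField} (hf : f ≠ 0) (x : X.left) :
    Resolution.IsDefinedAt (![1, f] : Fin (1 + 1) → X.left.functionField) x := by
  by_cases hx : IsRegularAt x f
  · exact ⟨0, (mem_lsChart_pair_zero_iff f x).2 hx⟩
  · have hxg : x ≠ genericPoint X.left := by
      rintro rfl
      exact hx (isRegularAt_genericPoint f)
    have hinv : IsRegularAt x f⁻¹ :=
      (CurvePlaces.mem_place_iff hxg).1
        (((CurvePlaces.place X x hxg).toValuationSubring.mem_or_inv_mem f).resolve_left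
          fun h ↦ hx ((CurvePlaces.mem_place_iff hxg).1 h))
    refine ⟨1, (Resolution.mem_lsChart_iff _).2 ⟨hf, ?_⟩⟩
    rw [Fin.forall_fin_two]
    simp only [Fin.isValue, Matrix.cons_val_zero, Matrix.cons_val_one, one_div, div_self hf]
    exact ⟨hinv, isRegularAt_one⟩

/-- **The morphism `(1 : f) : X → ℙ¹` of a smooth complete curve is finite** as soon as `f` has a
pole (a point `P` where it is not regular): it is proper (`X` is proper and `ℙ¹` separated over
`ℂ`), and its fibres over the closed points of `ℙ¹` are finite — such a fibre is a closed subset of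
`X` missing the generic point (the generic point maps into `D₊(x₀)` as `f` is regular there, `P`
does not), hence a closed set of closed points of the noetherian sober `X`, a finite set
(`finite_of_isClosed_singleton`) — so Zariski's Main Theorem applies
(`Morphisms.isFinite_of_isProper_of_finite_preimage_closedPoint`). -/
theorem isFinite_toProjOfVec_pair {f : X.left.functionField} (hf : f ≠ 0) {P : X.left}
    (hP : ¬ IsRegularAt P f) :
    IsFinite (Resolution.toProjOfVec (![1, f] : Fin (1 + 1) → X.left.functionField) X.hom
      (isDefinedAt_pair hf)) := by
  set φ := Resolution.toProjOfVec (![1, f] : Fin (1 + 1) → X.left.functionField) X.hom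
    (isDefinedAt_pair hf) with hφ
  -- `φ` is proper
  haveI : IsSeparated (Segre.toSpec (Fin (1 + 1)) ℂ) := by
    have h := CurveNet.isSeparated_projectiveSpace_hom 1 ℂ
    rwa [projectiveSpace_hom_eq_toSpec] at h
  haveI : IsProper (φ ≫ Segre.toSpec (Fin (1 + 1)) ℂ) := by
    rw [hφ, Resolution.toProjOfVec_toSpec]
    infer_instance
  haveI : IsProper φ := IsProper.of_comp φ (Segre.toSpec (Fin (1 + 1)) ℂ)
  -- the target is Jacobson, the source noetherian
  haveI : JacobsonSpace (Proj (Segre.grading (Fin (1 + 1)) ℂ)) := by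
    haveI : IsProper (projectiveSpace 1 ℂ).hom := isProper_projectiveSpace 1 ℂ
    exact ComplexPoints.jacobsonSpace_left (X := projectiveSpace 1 ℂ)
  haveI : IsLocallyNoetherian X.left := LocallyOfFiniteType.isLocallyNoetherian X.hom
  haveI : CompactSpace X.left := QuasiCompact.compactSpace_of_compactSpace X.hom
  haveI : IsNoetherian X.left := {}
  have hU : φ ⁻¹ᵁ Proj.basicOpen (Segre.grading (Fin (1 + 1)) ℂ) (MvPolynomial.X 0) =
      Resolution.lsChart (![1, f] : Fin (1 + 1) → X.left.functionField) 0 :=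
    Resolution.toProjOfVec_preimage_basicOpen _ X.hom _ 0
  refine Morphisms.isFinite_of_isProper_of_finite_preimage_closedPoint φ fun y hy ↦ ?_
  have hcl : IsClosed (φ.base ⁻¹' {y}) := hy.preimage φ.base.hom.continuous
  -- the fibre over the closed point `y` misses the generic point
  have hξ : genericPoint X.left ∉ φ.base ⁻¹' {y} := by
    intro hgen
    have hall : ∀ x : X.left, x ∈ φ.base ⁻¹' {y} := fun x ↦ by
      have hx : x ∈ closure {genericPoint X.left} := by
        rw [(genericPoint_spec X.left).def]
        trivial
      exact hcl.closure_subset_iff.2 (Set.singleton_subset_iff.2 hgen) hx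
    have h1 : genericPoint X.left ∈ φ ⁻¹ᵁ Proj.basicOpen _ (MvPolynomial.X 0) := by
      rw [hU]
      exact (mem_lsChart_pair_zero_iff f _).2 (isRegularAt_genericPoint f)
    have h2 : P ∉ φ ⁻¹ᵁ Proj.basicOpen _ (MvPolynomial.X 0) := by
      rw [hU]
      exact fun h ↦ hP ((mem_lsChart_pair_zero_iff f _).1 h)
    have e1 : φ.base P = y := hall P
    have e2 : φ.base (genericPoint X.left) = y := hgen
    exact h2 (show φ.base P ∈ Proj.basicOpen _ (MvPolynomial.X 0) by rw [e1, ← e2]; exact h1)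
  -- hence it consists of closed points, and is finite
  haveI : QuasiSober (φ.base ⁻¹' {y}) := hcl.isClosedEmbedding_subtypeVal.quasiSober
  have hfin : Finite (φ.base ⁻¹' {y}) := finite_of_isClosed_singleton fun z ↦ by
    have hz : (z : X.left) ≠ genericPoint X.left := fun h ↦ hξ (h ▸ z.2)
    have h : IsClosed ((Subtype.val : φ.base ⁻¹' {y} → X.left) ⁻¹' {(z : X.left)}) :=
      (CurvePlaces.isClosed_singleton X hz).preimage continuous_subtype_val
    convert h using 1
    ext w
    simp only [Set.mem_singleton_iff, Set.mem_preimage, Subtype.ext_iff]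
  exact Set.finite_coe_iff.2 hfin

/-- **Stub `stub_supply` for curves (`n = 1`).** On a smooth projective complex curve `X` pick a
complex point `P` and a rational function `f` regular exactly off `P`
(`exists_isRegularAt_iff_ne_pt`); the finite morphism `φ = (1 : f) : X → ℙ¹`
(`isFinite_toProjOfVec_pair`) has `φ⁻¹ D₊(x₀) = {f regular} = X ∖ P`, which is therefore AFFINE
(preimage of the affine `D₊(x₀)` under an affine morphism); `Y = Spec ℂ`, `f = P : Spec ℂ ⟶ X`
(a closed immersion onto the closed point `P`, smooth projective of dimension `0`). -/
theorem stub_supply_one ⦃X : SchemeOver ℂ⦄ (hX : IsSmoothProjective 1 X) :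
    ∃ (Y : SchemeOver ℂ) (f : Y ⟶ X) (U : X.left.Opens),
      IsSmoothProjective 0 Y ∧ IsClosedImmersion f.left ∧ IsAffineOpen U ∧
        (U : Set X.left) = (Set.range f.left.base)ᶜ ∧ Set.Nonempty (Set.range f.left.base)ᶜ := by
  haveI : IsIntegral X.left := IsSmoothProjective.isIntegral_holds hX
  haveI := hX.smoothOfRelativeDimension
  haveI : IsProper X.hom := IsSmoothProjective.isProper_holds hX
  haveI : GeometricallyIntegral X.hom := IsSmoothProjective.geometricallyIntegral_holds hX
  haveI : LocallyOfFiniteType X.hom := inferInstance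
  -- a complex point `P` and a rational function regular exactly off `P`
  obtain ⟨P, -⟩ := ComplexPoints.exists_pt_mem (X := X) (Z := Set.univ) Set.univ_nonempty
    isOpen_univ.isLocallyClosed
  obtain ⟨g, hg⟩ := exists_isRegularAt_iff_ne_pt X P
  have hgP : ¬ IsRegularAt P.pt g := fun h ↦ (hg P.pt).1 h rfl
  have hg0 : g ≠ 0 := by
    rintro rfl
    exact hgP isRegularAt_zero
  -- the finite morphism `φ = (1 : g) : X → ℙ¹` and the affine open `φ⁻¹ D₊(x₀) = X ∖ P`
  set φ := Resolution.toProjOfVec (![1, g] : Fin (1 + 1) → X.left.functionField) X.hom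
    (isDefinedAt_pair hg0) with hφ
  haveI : IsFinite φ := isFinite_toProjOfVec_pair hg0 hgP
  have hU : φ ⁻¹ᵁ Proj.basicOpen (Segre.grading (Fin (1 + 1)) ℂ) (MvPolynomial.X 0) =
      Resolution.lsChart (![1, g] : Fin (1 + 1) → X.left.functionField) 0 :=
    Resolution.toProjOfVec_preimage_basicOpen _ X.hom _ 0
  have hrange : Set.range P.left.base = {P.pt} := by
    refine Set.Subset.antisymm (AlgPoints.range_left_subset P (Set.mem_singleton _)) ?_
    rw [Set.singleton_subset_iff]
    exact ⟨IsLocalRing.closedPoint ℂ, rfl⟩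
  refine ⟨specOver ℂ ℂ, P,
    φ ⁻¹ᵁ Proj.basicOpen (Segre.grading (Fin (1 + 1)) ℂ) (MvPolynomial.X 0),
    ?_, AlgPoints.isClosedImmersion_toSpecHom X P, ?_, ?_, ?_⟩
  · -- `Spec ℂ` is smooth projective of dimension `0`
    refine (isSmoothProjective_unit_holds ℂ : IsSmoothProjective 0 (𝟙_ (SchemeOver ℂ))).of_iso ?_
    exact (Over.isoMk (Iso.refl _) (by
      simp only [Iso.refl_hom, Over.mk_hom, Algebra.algebraMap_self, CommRingCat.ofHom_id,
        Spec.map_id]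
      rfl) : specOver ℂ ℂ ≅ 𝟙_ (SchemeOver ℂ)).symm
  · exact (Proj.isAffineOpen_basicOpen _ _ (Segre.X_mem ℂ (0 : Fin (1 + 1))) one_pos).preimage φ
  · rw [hrange, hU]
    ext x
    rw [SetLike.mem_coe, mem_lsChart_pair_zero_iff, Set.mem_compl_iff, Set.mem_singleton_iff]
    exact hg x
  · rw [hrange, Set.nonempty_compl, Set.ne_univ_iff_exists_notMem]
    exact ⟨genericPoint X.left, fun h ↦ pt_ne_genericPoint X P (Set.mem_singleton_iff.1 h).symm⟩

end Curve

/-- **Stub `stub_supply` for `n ≥ 2` (crux `SectionalSource`, line `birth`)** — BERTINI SUPPLY OF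
AFFINE-COMPLEMENT HYPERPLANE SECTIONS: a smooth projective complex `X` of dimension `n ≥ 2` contains
a smooth projective closed subscheme `Y` of dimension `n − 1` (a smooth member of a good pencil of
hyperplane sections, `exists_goodPencil`, through the blow-down) whose complement is ONE non-empty
affine open (`X ∩ D₊(ℓ)`, the preimage of a basic open of `ℙᴺ` under the closed immersion). -/
theorem stub_supply_of_two_le :
    ∀ ⦃n : ℕ⦄ ⦃X : Literature.AlgebraicGeometry.Motives.SchemeOver ℂ⦄,
      Literature.AlgebraicGeometry.Motives.IsSmoothProjective n X → 2 ≤ n →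
      ∃ (Y : Literature.AlgebraicGeometry.Motives.SchemeOver ℂ) (f : Y ⟶ X) (U : X.left.Opens),
        Literature.AlgebraicGeometry.Motives.IsSmoothProjective (n - 1) Y ∧
          AlgebraicGeometry.IsClosedImmersion f.left ∧ AlgebraicGeometry.IsAffineOpen U ∧
          (U : Set X.left) = (Set.range f.left.base)ᶜ ∧ Set.Nonempty (Set.range f.left.base)ᶜ := by
  intro n X hX hn
  obtain ⟨m, rfl⟩ : ∃ m, n = m + 1 := ⟨n - 1, by omega⟩
  have hm : 1 ≤ m := by omega
  obtain ⟨N, ι, hι⟩ := hX.isProjectiveOver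
  haveI := hι
  obtain ⟨a, -, -, T, hTc, hTne, hfib⟩ := exists_goodPencil hX ι hm
  -- a complex point `s = [w]` of `ℙ¹` off the discriminant `T`
  haveI : LocallyOfFiniteType (projectiveSpace 1 ℂ).hom :=
    haveI : IsProper (projectiveSpace 1 ℂ).hom := isProper_projectiveSpace 1 ℂ
    inferInstance
  obtain ⟨s, hs⟩ := ComplexPoints.exists_pt_mem (X := projectiveSpace 1 ℂ) (Z := Tᶜ)
    (Set.nonempty_compl.2 hTne) hTc.isOpen_compl.isLocallyClosed
  obtain ⟨w, hw, rfl⟩ := ProjectiveSpace.exists_eq_pointOfVec s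
  have hY : IsSmoothProjective m (fiberOver (proj ι a) (ProjectiveSpace.pointOfVec ℂ w hw)) :=
    hfib _ hs
  haveI hf := isClosedImmersion_fiberι_blowDown_left ι a (ProjectiveSpace.pointOfVec ℂ w hw)
  haveI : LocallyOfFiniteType X.hom := by
    haveI := hX.smoothOfRelativeDimension
    haveI : Smooth X.hom := SmoothOfRelativeDimension.smooth (m + 1) X.hom
    infer_instance
  have hrange := range_fiberι_blowDown_base_eq_hyp ι a w hw
  refine ⟨fiberOver (proj ι a) (ProjectiveSpace.pointOfVec ℂ w hw),
    fiberι (proj ι a) (ProjectiveSpace.pointOfVec ℂ w hw) ≫ blowDown ι a,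
    Resolution.LinSec.XL (ιPP ι) (fun c ↦ w 1 * a 0 c - w 0 * a 1 c), hY, hf,
    Resolution.LinSec.isAffineOpen_XL (ιPP ι) _, ?_, ?_⟩
  · rw [hrange, Resolution.LinSec.hyp, compl_compl]
  · -- a surjective closed immersion `Y ⟶ X` would be a homeomorphism, forcing `m = m + 1`
    rw [Set.nonempty_compl]
    intro huniv
    have h := eq_of_isSmoothProjective_of_isHomeomorph hY hX
      (fiberι (proj ι a) (ProjectiveSpace.pointOfVec ℂ w hw) ≫ blowDown ι a)
      ((isHomeomorph_iff_isEmbedding_surjective).2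
        ⟨(fiberι (proj ι a) (ProjectiveSpace.pointOfVec ℂ w hw) ≫
            blowDown ι a).left.isClosedEmbedding.isEmbedding,
          Set.range_eq_univ.1 huniv⟩)
    omega

/-- **Stub `stub_supply` (crux `SectionalSource`, line `birth`) — BERTINI SUPPLY OF AFFINE-COMPLEMENT
HYPERSURFACE SECTIONS.** For `X` smooth projective of dimension `n ≥ 1` over `ℂ` there are a smooth
projective `Y` of dimension `n − 1`, a closed immersion `f : Y ⟶ X` and an AFFINE open `U ⊆ X` with
`U = X ∖ f(Y)` non-empty: for `n ≥ 2` a smooth member of a good pencil of hyperplane sections with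
complement `X ∩ D₊(ℓ)` (`stub_supply_of_two_le`); for `n = 1` a complex point `P` with `X ∖ P`
affine, the preimage of `𝔸¹ = D₊(x₀)` under the finite morphism `(1 : f) : X → ℙ¹` of a rational
function with its only pole at `P` (`stub_supply_one`). -/
theorem stub_supply :
    ∀ ⦃n : ℕ⦄ ⦃X : Literature.AlgebraicGeometry.Motives.SchemeOver ℂ⦄,
      Literature.AlgebraicGeometry.Motives.IsSmoothProjective n X → 1 ≤ n →
      ∃ (Y : Literature.AlgebraicGeometry.Motives.SchemeOver ℂ) (f : Y ⟶ X) (U : X.left.Opens),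
        Literature.AlgebraicGeometry.Motives.IsSmoothProjective (n - 1) Y ∧
          AlgebraicGeometry.IsClosedImmersion f.left ∧ AlgebraicGeometry.IsAffineOpen U ∧
          (U : Set X.left) = (Set.range f.left.base)ᶜ ∧ Set.Nonempty (Set.range f.left.base)ᶜ := by
  intro n X hX hn
  rcases Nat.lt_or_ge n 2 with h2 | h2
  · obtain rfl : n = 1 := by omega
    exact stub_supply_one hX
  · exact stub_supply_of_two_le hX h2

end Summit.HodgeConjecture.HodgeConjecture.Theorems

end
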